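import Summits.QuantumFields.YangMills.Theorems.BalabanUVNodesClustersCore
import Summits.QuantumFields.YangMills.Theorems.BalabanUVNodesN19LedgerLinkSync

/-!
# YM-DAG node N19 (= NE7 proper) AT THE SPINE CARRIERS: the K5 stub `YMDAG.UVSplit.S_N19 SRec Inputs` of the landed cut
# (`BalabanUVNodesClustersCore` p416552) from ANY ∃δ-edge, with the remainder OF RECORD pinned by choice — INTERIM BOOKKEEPING
# (plan word [YMPLAN-G62-WORD-N19-JUNCTION], pub-ymgap INBOX l.10472; dagwriter l.10446; referee pin l.10444)

Cell `pub-ymgap`, HUMAN RULING D-0062 (Track A), seat `pub-ymgap-dag-n19-a` (-a KNIT-BY-NAME), generation 3; route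
`Summits/QuantumFields/YangMills/Theses/BalabanUVNodes.lean`, item `SpineGivenEndpoint` (stmt-QuantumFields-19182), cluster K5
«SpineMatching».  COUNT-NEUTRAL SUPPLY; superseded-not-edited at the plan's rev-1 restate (2026-08-30 – 09-01), whose DESIGN OF
RECORD is the alternative `S_N19′ := SRec … → Inputs … → ∃ δ, NE7.Core … δ ∧ Summable δ` with `δ` dropped from the carrier record
and U4′ retired (l.10472 (d)).

WHY.  Module 1's cut types the per-string spine datum conjunct-by-conjunct over ONE carrier bundle `S : SpineCarriers` that CARRIES
the remainder `S.δ`: `S_N19 SRec Inputs` concludes `NE7.Core S.l₀ S.vol S.T S.Bad (A − shA) (B − shB) S.δ` AT THE CARRIERS' OWN `δ`,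
and `S_U4 SRec` asserts `Summable S.δ`.  Every landed N19 knit (this seat's v1–v5, dag-n19-b's v1′, dag-n27-a's joins) produces
`∃ δ, NE7.Core … δ ∧ Summable δ` with a CHOICE-DEPENDENT `δ` (existentials inside NE5 ∕ NE9 ∕ (2.43) ∕ the centre clause).  This
file is the junction: the record predicate `SRec` pins `S.δ := deltaOfRecord …` (§1, by `Classical.choice`), and then

* `s_N19_of_coreEdge` (§3): ANY edge «`SRec ∧ Inputs` ⇒ `∃ δ, Core … δ ∧ Summable δ`» gives `S_N19 SRec Inputs`;
* `summable_delta_of_pin` (§3): `Summable S.δ` — U4′'s δ-half — holds.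

**REFEREE PIN OF RECORD (dag-ref-B [DAGREFB-G4-PIN-N19-DELTAOFRECORD-JUNK-VALUE], adopted by the plan l.10472 (b)):
`summable_deltaOfRecord` is TRUE BY CONSTRUCTION (the `else`-branch is `0`, the `then`-branch is `h.choose_spec.2`); under this
pin the U4′ conjunct `Summable S.δ` carries NO content — the ∃δ-edge hypothesis `∃ δ, NE7.Core … δ ∧ Summable δ` of
`core_deltaOfRecord` ∕ `s_N19_of_coreEdge` is the WHOLE content.  No U4′ conjunct is ever booked as progress.**
`core_summable_deltaOfRecord_iff` records that the junction loses nothing either: `Core ∧ Summable` at `deltaOfRecord` ⟺ the ∃δ-edge.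
Per the dagwriter's ask `deltaOfRecord` takes the Core carriers `(l₀, vol, T, Bad, P, Q)` as EXPLICIT arguments (not the bundle),
so a δ-free rev-1 record reuses it.  §2 is the choice-free companion [folklore]: `NE7.Core` is MONOTONE in `δ` on nonnegative
cores (`core_mono_delta`), whence `s_N19_of_dominatedEdge` for a record whose `S.δ` dominates an explicit remainder.  §4 is the
READING through this seat's synchronised ledger predicate: if `SRec ∧ Inputs` hand, with every carrier bundle, a
`N19LedgerLinkSync.LedgerAtSync` package at the shell-free cores together with the in-edges BY NAME (N16 `NE3Shape` +
`GaugeDominated`, N18 `NE5`, N22 `NE9 ∧ FadingMemory`, N17 via node U2's `InjectedRate`, (T) `LipBackground` + `PolyLipGrowth`,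
window memberships) — the hypothesis list of `core_summable_of_ledgerAtSync` (p414645) VERBATIM — then `S_N19 SRec Inputs`
(`s_N19_of_ledgerAtSyncReading`).

HONEST FRAMING.  Kernel bookkeeping over hypothesis SHAPES; ONE definition (`deltaOfRecord`, a choice function — no estimate),
theorems otherwise; 0 sorry; standard axioms.  NE7 is NOT PRINTED and NOT PROVED; no carrier of record (`SRec`) and no K4 hook
(`Inputs` = module 2's `RatesAt`) exists in the tree — both are PARAMETERS here; nothing of Bałaban's is asserted or instantiated;
N19 is NOT discharged; Track A count unmoved.  One finite four-torus at fixed ε — NOT infinite volume, NOT OS on ℝ⁴, NOT a mass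
gap, NOT Clay.
-/

set_option autoImplicit false

noncomputable section

open Finset MeasureTheory
open scoped BigOperators

namespace Summit.QuantumFields.YangMills.BalabanUVNodes.N19AtSpineCarriers

open Literature.MathematicalPhysics.QuantumFieldTheory.Balaban1983to89
open T4OutputRate T4RecentScale T4GoodClassBudget T4CauchySum T4TowerRateComposition T4TowerRateDischarge
open T4EtaRateMin (Readings NE3Shape)
open T4RateLiaison (GaugeDominated)
open Summit.QuantumFields.BalabanUV.T4Continuum.Spine
open Summit.QuantumFields.YangMills.BalabanUVNodes.N19LedgerLinkSync (LedgerDataSync LedgerAtSync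
  core_summable_of_ledgerAtSync)
open YMDAG.UVSplit (SpineCarriers SpineRecordPred InputsPred S_N19)

/-! ## §1 The remainder OF RECORD, pinned by choice -/

section Delta

variable {ι : Type*} [DecidableEq ι]

open Classical in
/-- **THE REMAINDER OF RECORD** of the two-run core matching on the Core carriers `(l₀, vol, T, Bad, P, Q)`: IF some summable `δ`
with `NE7.Core l₀ vol T Bad P Q δ` exists, a CHOSEN one; ELSE `0`.  A choice function — no estimate, no physics.  REFEREE PIN: its
summability is true by construction (`summable_deltaOfRecord`); all content sits in the ∃δ-edge.  Interim (rev-1 design drops `δ`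
from the carrier record).  (Classical decidability of the existential.) [folklore] -/
def deltaOfRecord (l₀ vol : ℝ) (T : ℕ → Finset ι) (Bad : ℕ → ℝ → Finset ι) (P Q : ℕ → ℝ → ι → ℝ) : ℕ → ℝ :=
  if h : ∃ δ : ℕ → ℝ, NE7.Core l₀ vol T Bad P Q δ ∧ Summable δ then h.choose else 0

variable {l₀ vol : ℝ} {T : ℕ → Finset ι} {Bad : ℕ → ℝ → Finset ι} {P Q : ℕ → ℝ → ι → ℝ}

/-- **PIN (content-free by construction)**: the remainder of record is summable in BOTH branches — `h.choose_spec.2`, resp.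
`summable_zero`.  This theorem carries NO information about Bałaban's runs. [folklore] -/
theorem summable_deltaOfRecord : Summable (deltaOfRecord l₀ vol T Bad P Q) := by
  unfold deltaOfRecord
  split_ifs with h
  · exact h.choose_spec.2
  · exact summable_zero

/-- **THE JUNCTION**: an ∃δ-edge `∃ δ, NE7.Core … δ ∧ Summable δ` puts `NE7.Core` AT the remainder of record (`h.choose_spec.1`).
The hypothesis is the WHOLE content. [folklore] -/
theorem core_deltaOfRecord (h : ∃ δ : ℕ → ℝ, NE7.Core l₀ vol T Bad P Q δ ∧ Summable δ) :
    NE7.Core l₀ vol T Bad P Q (deltaOfRecord l₀ vol T Bad P Q) := by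
  unfold deltaOfRecord
  rw [dif_pos h]
  exact h.choose_spec.1

/-- The junction loses nothing: `Core ∧ Summable` at the remainder of record ⟺ the ∃δ-edge. [folklore] -/
theorem core_summable_deltaOfRecord_iff :
    (NE7.Core l₀ vol T Bad P Q (deltaOfRecord l₀ vol T Bad P Q) ∧ Summable (deltaOfRecord l₀ vol T Bad P Q)) ↔
      ∃ δ : ℕ → ℝ, NE7.Core l₀ vol T Bad P Q δ ∧ Summable δ :=
  ⟨fun h => ⟨_, h⟩, fun h => ⟨core_deltaOfRecord h, summable_deltaOfRecord⟩⟩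

end Delta

/-! ## §2 The choice-free companion: `NE7.Core` is monotone in the remainder on nonnegative cores [folklore] -/

section Mono

variable {ι : Type*} [DecidableEq ι] {l₀ vol : ℝ} {T : ℕ → Finset ι} {Bad : ℕ → ℝ → Finset ι} {P Q : ℕ → ℝ → ι → ℝ}
  {δ δ' : ℕ → ℝ}

/-- **`NE7.Core` IS MONOTONE IN `δ`**: with `vol ≥ 0` and run A's cores `P ≥ 0` on the good classes, enlarging the remainder
pointwise (`δ K ≤ δ′ K`) preserves the two-sided sandwich (`e^{c−vol·δ′} ≤ e^{c−vol·δ}`, `e^{c+vol·δ} ≤ e^{c+vol·δ′}`). [folklore] -/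
theorem core_mono_delta (hvol : 0 ≤ vol) (hP : ∀ K t, |t| ≤ l₀ → ∀ τ ∈ T K \ Bad K t, 0 ≤ P K t τ)
    (hle : ∀ K, δ K ≤ δ' K) (h : NE7.Core l₀ vol T Bad P Q δ) : NE7.Core l₀ vol T Bad P Q δ' := by
  intro K
  obtain ⟨c, hc⟩ := h K
  refine ⟨c, fun t ht τ hτ => ?_⟩
  obtain ⟨h1, h2⟩ := hc t ht τ hτ
  have hv : vol * δ K ≤ vol * δ' K := mul_le_mul_of_nonneg_left (hle K) hvol
  have hP0 := hP K t ht τ hτ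
  constructor
  · exact (mul_le_mul_of_nonneg_right (Real.exp_le_exp.mpr (by linarith)) hP0).trans h1
  · exact h2.trans (mul_le_mul_of_nonneg_right (Real.exp_le_exp.mpr (by linarith)) hP0)

end Mono

/-! ## §3 The K5 stub `S_N19 SRec Inputs` from an ∃δ-edge -/

section Stub

variable {N : ℕ} [NeZero N]

/-- **GLUE: `S_N19` IS INHERITED BY REFINEMENT** of the carrier predicate and of the input hook: a record predicate carrying MORE
than a reading predicate, and a K4 hook implying the reading's inputs, inherit `S_N19`. [folklore] -/
theorem s_N19_mono {SRec SRec' : SpineRecordPred N} {Inputs Inputs' : InputsPred N}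
    (hS : ∀ (F : T4Continuum.T4Family) (D : YMDAG.UVSplit.Datum F N) (g₀ : ℕ → ℝ) (os : List (T4Continuum.ULoop F))
      (S : SpineCarriers), SRec' F D g₀ os S → SRec F D g₀ os S)
    (hI : ∀ (F : T4Continuum.T4Family) (D : YMDAG.UVSplit.Datum F N) (g₀ : ℕ → ℝ) (os : List (T4Continuum.ULoop F)),
      Inputs' F D g₀ os → Inputs F D g₀ os)
    (h : S_N19 SRec Inputs) : S_N19 SRec' Inputs' :=
  fun F D g₀ os S hS' hI' => h F D g₀ os S (hS F D g₀ os S hS') (hI F D g₀ os hI')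

/-- **`S_N19` FROM ANY ∃δ-EDGE, AT THE REMAINDER OF RECORD** [bookkeeping].  If the carrier predicate PINS the remainder by choice
(`S.δ = deltaOfRecord S.l₀ S.vol S.T S.Bad (A − shA) (B − shB)`) and the pair `SRec ∧ Inputs` yields an ∃δ-edge on the shell-free
cores — the shape of every landed N19 knit —, then `YMDAG.UVSplit.S_N19 SRec Inputs`.  The edge hypothesis is the WHOLE content
(referee pin). [folklore] -/
theorem s_N19_of_coreEdge (SRec : SpineRecordPred N) (Inputs : InputsPred N)
    (hpin : ∀ (F : T4Continuum.T4Family) (D : YMDAG.UVSplit.Datum F N) (g₀ : ℕ → ℝ) (os : List (T4Continuum.ULoop F))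
      (S : SpineCarriers), SRec F D g₀ os S → letI := S.dec
      S.δ = deltaOfRecord S.l₀ S.vol S.T S.Bad (fun K t τ => S.A K t τ - S.shA K t τ) (fun K t τ => S.B K t τ - S.shB K t τ))
    (hedge : ∀ (F : T4Continuum.T4Family) (D : YMDAG.UVSplit.Datum F N) (g₀ : ℕ → ℝ) (os : List (T4Continuum.ULoop F))
      (S : SpineCarriers), SRec F D g₀ os S → Inputs F D g₀ os → letI := S.dec
      ∃ δ : ℕ → ℝ, NE7.Core S.l₀ S.vol S.T S.Bad (fun K t τ => S.A K t τ - S.shA K t τ)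
        (fun K t τ => S.B K t τ - S.shB K t τ) δ ∧ Summable δ) :
    S_N19 SRec Inputs := by
  intro F D g₀ os S hS hI
  letI := S.dec
  rw [hpin F D g₀ os S hS]
  exact core_deltaOfRecord (hedge F D g₀ os S hS hI)

/-- **U4′'s δ-HALF UNDER THE PIN — CONTENT-FREE** (referee pin of record): a carrier predicate pinning `S.δ` to the remainder of
record makes `Summable S.δ` hold for every bundle it pins, BY CONSTRUCTION of `deltaOfRecord`.  Never to be booked as progress. [folklore] -/
theorem summable_delta_of_pin (SRec : SpineRecordPred N)
    (hpin : ∀ (F : T4Continuum.T4Family) (D : YMDAG.UVSplit.Datum F N) (g₀ : ℕ → ℝ) (os : List (T4Continuum.ULoop F))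
      (S : SpineCarriers), SRec F D g₀ os S → letI := S.dec
      S.δ = deltaOfRecord S.l₀ S.vol S.T S.Bad (fun K t τ => S.A K t τ - S.shA K t τ) (fun K t τ => S.B K t τ - S.shB K t τ))
    (F : T4Continuum.T4Family) (D : YMDAG.UVSplit.Datum F N) (g₀ : ℕ → ℝ) (os : List (T4Continuum.ULoop F))
    (S : SpineCarriers) (hS : SRec F D g₀ os S) : Summable S.δ := by
  letI := S.dec
  rw [hpin F D g₀ os S hS]
  exact summable_deltaOfRecord

/-- **THE CHOICE-FREE VARIANT** [bookkeeping]: if `SRec` keeps run A's shell-free cores nonnegative on the good classes with `vol ≥ 0`,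
and `SRec ∧ Inputs` yields a remainder `δ` with `NE7.Core … δ` DOMINATED by the carriers' own `S.δ`, then `S_N19 SRec Inputs`
(`core_mono_delta`).  (Summability of `S.δ` is then the record's separate burden — U4′ with content.) [folklore] -/
theorem s_N19_of_dominatedEdge (SRec : SpineRecordPred N) (Inputs : InputsPred N)
    (hpos : ∀ (F : T4Continuum.T4Family) (D : YMDAG.UVSplit.Datum F N) (g₀ : ℕ → ℝ) (os : List (T4Continuum.ULoop F))
      (S : SpineCarriers), SRec F D g₀ os S → letI := S.dec
      0 ≤ S.vol ∧ ∀ K t, |t| ≤ S.l₀ → ∀ τ ∈ S.T K \ S.Bad K t, 0 ≤ S.A K t τ - S.shA K t τ)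
    (hedge : ∀ (F : T4Continuum.T4Family) (D : YMDAG.UVSplit.Datum F N) (g₀ : ℕ → ℝ) (os : List (T4Continuum.ULoop F))
      (S : SpineCarriers), SRec F D g₀ os S → Inputs F D g₀ os → letI := S.dec
      ∃ δ : ℕ → ℝ, NE7.Core S.l₀ S.vol S.T S.Bad (fun K t τ => S.A K t τ - S.shA K t τ)
        (fun K t τ => S.B K t τ - S.shB K t τ) δ ∧ ∀ K, δ K ≤ S.δ K) :
    S_N19 SRec Inputs := by
  intro F D g₀ os S hS hI
  letI := S.dec
  obtain ⟨hvol, hP⟩ := hpos F D g₀ os S hS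
  obtain ⟨δ, hcore, hle⟩ := hedge F D g₀ os S hS hI
  exact core_mono_delta hvol hP hle hcore

end Stub

/-! ## §4 The READING through the synchronised ledger predicate: what `SRec ∧ Inputs` must hand for N19 to follow by name -/

section Reading

variable {N : ℕ} [NeZero N]

/-- **`S_N19` FOR EVERY SYNCHRONISED-LEDGER READING** [bookkeeping].  If the carrier predicate pins the remainder of record (§1) and
the pair `SRec ∧ Inputs` hands, with every carrier bundle `S` it pins, the package of `N19LedgerLinkSync.core_summable_of_ledgerAtSync`
VERBATIM at the shell-free cores `(S.A − S.shA, S.B − S.shB)`: rate carriers `C` (decidable domains), a field space `ι′` (measurable)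
with NE3's reading family `R : Readings ι′ X′`, ledger data `L : LedgerDataSync C F′ ι′ S.ι` with `LedgerAtSync L S.l₀ S.vol S.T S.Bad …
R EA EB κ g uA uB ω θc θ₅ θ₃` (cell NODE O: the synchronised (2.25) term format, reference ledger, booking, other kinds, size, rate
ordering), AND the in-edges BY NAME — N16 `NE3Shape R C₃ θ₃` (`0 ≤ C₃`) with `GaugeDominated R uA uB`, N18 `NE5 EA EB W κ θ₅ C₅`
(`0 ≤ θ₅, C₅`), N22 `NE9 EA W κ Λ ∧ FadingMemory C₉ ω Λ` (`0 ≤ ω`), N17 through node U2's output `InjectedRate Cd 0 θc disc` on the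
box `0 < g K i ≤ γ` (`0 ≤ Cd, θc`), the bracket (T) `LipBackground EA W κ CU` + `PolyLipGrowth CU g Pg q` (`0 ≤ Pg`), both runs'
re-indexed couplings in `W` — then `YMDAG.UVSplit.S_N19 SRec Inputs`.  (`SRec` = NODE 00's carriers of record, `Inputs` = module 2's
K4 hook `RatesAt`: PARAMETERS; the ∃-package is what they must jointly supply.)  NON-VACUITY of the package is on file:
`N19LedgerLinkSync.ledgerAtSync_toy` inhabits `LedgerAtSync` non-degenerately and the edge fires on toy in-edges
(`N19CentreSync.spineNodes_sync_nonvacuous`, `N19OtherKindsU5b.nodes_u5b_nonvacuous`).  NOT NE7. [folklore] -/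
theorem s_N19_of_ledgerAtSyncReading (SRec : SpineRecordPred N) (Inputs : InputsPred N)
    (hpin : ∀ (F : T4Continuum.T4Family) (D : YMDAG.UVSplit.Datum F N) (g₀ : ℕ → ℝ) (os : List (T4Continuum.ULoop F))
      (S : SpineCarriers), SRec F D g₀ os S → letI := S.dec
      S.δ = deltaOfRecord S.l₀ S.vol S.T S.Bad (fun K t τ => S.A K t τ - S.shA K t τ) (fun K t τ => S.B K t τ - S.shB K t τ))
    (hread : ∀ (F : T4Continuum.T4Family) (D : YMDAG.UVSplit.Datum F N) (g₀ : ℕ → ℝ) (os : List (T4Continuum.ULoop F))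
      (S : SpineCarriers), SRec F D g₀ os S → Inputs F D g₀ os → letI := S.dec
      ∃ (C : Carriers) (_ : DecidableEq C.Dom) (F' : Type) (ι' X' : Type) (_ : MeasurableSpace ι')
        (L : LedgerDataSync C F' ι' S.ι) (R : Readings ι' X') (W : Set (ℕ → ℝ)) (EA : Functional C C.BgA)
        (EB : Functional C C.BgB) (κ θ₅ C₅ C₉ ω θc Cd γ C₃ θ₃ Pg : ℝ) (q : ℕ) (Λm : ℕ → ℕ → ℝ)
        (CU : (ℕ → ℝ) → ℕ → ℝ) (g : ℕ → ℕ → ℝ) (uA : ℕ → ι' → C.BgA) (uB : ℕ → ι' → C.BgB),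
        LedgerAtSync L S.l₀ S.vol S.T S.Bad (fun K t τ => S.A K t τ - S.shA K t τ) (fun K t τ => S.B K t τ - S.shB K t τ)
          R EA EB κ g uA uB ω θc θ₅ θ₃ ∧
        NE3Shape R C₃ θ₃ ∧ 0 ≤ C₃ ∧ GaugeDominated R uA uB ∧
        NE5 EA EB W κ θ₅ C₅ ∧ 0 ≤ θ₅ ∧ 0 ≤ C₅ ∧
        (NE9 EA W κ Λm ∧ T4OutputRate.FadingMemory C₉ ω Λm) ∧ 0 ≤ ω ∧
        InjectedRate Cd 0 θc (fun K j => T4CouplingMatching.disc (g K) (g (K + 1)) j) ∧ 0 ≤ Cd ∧ 0 ≤ θc ∧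
        (∀ K i, i ≤ K → 0 < g K i ∧ g K i ≤ γ) ∧
        LipBackground EA W κ CU ∧ PolyLipGrowth CU g Pg q ∧ 0 ≤ Pg ∧
        (∀ K, g K ∈ W) ∧ (∀ K, (fun i => g (K + 1) (i + 1)) ∈ W)) :
    S_N19 SRec Inputs := by
  refine s_N19_of_coreEdge SRec Inputs hpin fun F D g₀ os S hS hI => ?_
  letI := S.dec
  obtain ⟨C, _, F', ι', X', _, L, R, W, EA, EB, κ, θ₅, C₅, C₉, ω, θc, Cd, γ, C₃, θ₃, Pg, q, Λm, CU, g, uA, uB, hL, h16, hC₃,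
    hgd, h18, hθ₅, hC₅, h22, hω, hinj, hCd, hθc, hbox, hU, hG, hPg, hgA, hgB⟩ := hread F D g₀ os S hS hI
  exact core_summable_of_ledgerAtSync hL h16 hC₃ hgd h18 hθ₅ hC₅ h22 hω hinj hCd hθc hbox hU hG hPg hgA hgB

end Reading

end Summit.QuantumFields.YangMills.BalabanUVNodes.N19AtSpineCarriers

end
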